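import Summits.Ventures.PercRepro.S1EightSixFourSixFourEight

/-!
# PercRepro — THE EXTENSION INCIDENCE: LOW-RANK `k`-SETS AGAINST `(k + 1)`-SETS (p2, gen 28; SUBCLAIM-S1 §6.10
(xvii)(p))

In a finite matroid on `n` points, every `k`-set `Q` of rank `≤ b` has `n − k` extensions `Q ∪ {x}`, all of rank
`≤ b + 1`, and every `(k + 1)`-set contains `k + 1` sets of size `k`; counting the incidences,
`(n − k) · #{k-sets of rank ≤ b} ≤ (k + 1) · #{(k + 1)-sets of rank ≤ b + 1}`. Used as «a rank-`≤ 3` four-set kills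
its five extensions» for the corank-`4` parts of the `(8, 6)` cell. Nothing is claimed about any cell.

* `lowRankSets`, `extensionPairs`; **`sub_mul_ncard_lowRankSets_le`**.
Axioms: standard.
-/

open scoped Matroid

namespace PercRepro

namespace S1

open Set

variable {α : Type}

/-- The `k`-sets of rank at most `b`. -/
def lowRankSets (M : Matroid α) (k b : ℕ) : Set (Set α) :=
  {Q : Set α | Q ⊆ M.E ∧ Q.ncard = k ∧ M.eRk Q ≤ (b : ℕ∞)}

/-- The incidences «a low-rank `k`-set inside a `(k + 1)`-set». -/
def extensionPairs (M : Matroid α) (k b : ℕ) : Set (Set α × Set α) :=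
  {R : Set α × Set α | R.1 ∈ lowRankSets M k b ∧ R.2 ⊆ M.E ∧ R.2.ncard = k + 1 ∧ R.1 ⊆ R.2}

/-- The low-rank `k`-sets are finite. -/
theorem lowRankSets_finite (M : Matroid α) [M.Finite] (k b : ℕ) : (lowRankSets M k b).Finite :=
  M.ground_finite.finite_subsets.subset (fun _ hQ => hQ.1)

/-- The extension incidences are finite. -/
theorem extensionPairs_finite (M : Matroid α) [M.Finite] (k b : ℕ) : (extensionPairs M k b).Finite :=
  (M.ground_finite.finite_subsets.prod M.ground_finite.finite_subsets).subset
    (fun _ hR => ⟨hR.1.1, hR.2.1⟩)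

/-- **THE EXTENSION INCIDENCE**: `(n − k) · #(k-sets of rank ≤ b) ≤ (k + 1) · #((k + 1)-sets of rank ≤ b + 1)`. -/
theorem sub_mul_ncard_lowRankSets_le (M : Matroid α) [M.Finite] (k b : ℕ) :
    (M.E.ncard - k) * (lowRankSets M k b).ncard ≤ (k + 1) * (lowRankSets M (k + 1) (b + 1)).ncard := by
  have hKfin := lowRankSets_finite M k b
  have hLfin := lowRankSets_finite M (k + 1) (b + 1)
  have hIfin := extensionPairs_finite M k b
  -- lower side: each low-rank `k`-set has `n − k` extensions
  have heq : extensionPairs M k b = ⋃ Q ∈ lowRankSets M k b,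
      ({Q} ×ˢ {P : Set α | P ⊆ M.E ∧ P.ncard = k + 1 ∧ Q ⊆ P} : Set (Set α × Set α)) := by
    ext ⟨Q, P⟩
    simp only [extensionPairs, mem_setOf_eq, mem_iUnion, mem_prod, mem_singleton_iff, exists_prop]
    constructor
    · rintro ⟨hQ, hPE, hP, hQP⟩
      exact ⟨Q, hQ, rfl, hPE, hP, hQP⟩
    · rintro ⟨Q', hQ', rfl, hPE, hP, hQP⟩
      exact ⟨hQ', hPE, hP, hQP⟩
  have hfib : ∀ Q ∈ lowRankSets M k b,
      (({Q} ×ˢ {P : Set α | P ⊆ M.E ∧ P.ncard = k + 1 ∧ Q ⊆ P} : Set (Set α × Set α))).Finite :=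
    fun Q _ => (finite_singleton Q).prod (M.ground_finite.finite_subsets.subset (fun _ hP => hP.1))
  have hdisj : (lowRankSets M k b).PairwiseDisjoint
      (fun Q : Set α => ({Q} ×ˢ {P : Set α | P ⊆ M.E ∧ P.ncard = k + 1 ∧ Q ⊆ P} : Set (Set α × Set α))) := by
    intro Q _ Q' _ hQQ
    rw [Function.onFun, Set.disjoint_left]
    rintro ⟨C, P⟩ ⟨hC1, -⟩ ⟨hC2, -⟩
    apply hQQ
    rw [mem_singleton_iff] at hC1 hC2
    rw [← hC1, ← hC2]
  have hlow : (M.E.ncard - k) * (lowRankSets M k b).ncard = (extensionPairs M k b).ncard := by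
    rw [heq, hKfin.ncard_biUnion hfib hdisj, finsum_mem_eq_finite_toFinset_sum _ hKfin]
    rw [Finset.sum_congr rfl (g := fun _ => M.E.ncard - k) ?_]
    · rw [Finset.sum_const, smul_eq_mul, ncard_eq_toFinset_card _ hKfin, mul_comm]
    · intro Q hQ
      rw [Finite.mem_toFinset] at hQ
      rw [ncard_prod, ncard_singleton, one_mul]
      have hQE : Q ⊆ M.E := hQ.1
      have hQk : Q.ncard = k := hQ.2.1
      have hQfin : Q.Finite := M.ground_finite.subset hQE
      have himg : {P : Set α | P ⊆ M.E ∧ P.ncard = k + 1 ∧ Q ⊆ P} = (fun x => insert x Q) '' (M.E \ Q) := by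
        ext P
        simp only [mem_setOf_eq, mem_image, mem_sdiff]
        constructor
        · rintro ⟨hPE, hP, hQP⟩
          have h1 : (P \ Q).ncard = 1 := by rw [ncard_sdiff' hQP (M.ground_finite.subset hPE), hP, hQk]; omega
          obtain ⟨x, hx⟩ := ncard_eq_one.mp h1
          have hxmem : x ∈ P \ Q := by rw [hx]; exact mem_singleton x
          refine ⟨x, ⟨hPE hxmem.1, hxmem.2⟩, ?_⟩
          ext w
          constructor
          · rintro (rfl | hw)
            · exact hxmem.1
            · exact hQP hw
          · intro hw
            by_cases hwQ : w ∈ Q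
            · exact Or.inr hwQ
            · have : w ∈ P \ Q := ⟨hw, hwQ⟩
              rw [hx] at this
              exact Or.inl this
        · rintro ⟨x, ⟨hxE, hxQ⟩, rfl⟩
          exact ⟨insert_subset hxE hQE, by rw [ncard_insert_of_notMem hxQ hQfin, hQk], subset_insert _ _⟩
      rw [himg, InjOn.ncard_image, ncard_sdiff' hQE M.ground_finite, hQk]
      intro x hx y hy hxy
      have hxy' : insert x Q = insert y Q := hxy
      have : x ∈ insert y Q := hxy' ▸ mem_insert x Q
      rcases this with h | h
      · exact h
      · exact absurd h hx.2
  -- upper side: the incidences lie over the low-rank `(k + 1)`-sets, at most `k + 1` each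
  have hup : extensionPairs M k b ⊆ ⋃ P ∈ lowRankSets M (k + 1) (b + 1), {R ∈ extensionPairs M k b | R.2 = P} := by
    rintro ⟨Q, P⟩ ⟨hQ, hPE, hP, hQP⟩
    rw [mem_iUnion₂]
    refine ⟨P, ⟨hPE, hP, ?_⟩, ⟨hQ, hPE, hP, hQP⟩, rfl⟩
    -- `P = insert x Q` has rank at most `b + 1`
    have h1 : (P \ Q).ncard = 1 := by rw [ncard_sdiff' hQP (M.ground_finite.subset hPE), hP, hQ.2.1]; omega
    obtain ⟨x, hx⟩ := ncard_eq_one.mp h1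
    have hxmem : x ∈ P \ Q := by rw [hx]; exact mem_singleton x
    have hPeq : P = insert x Q := by
      ext w
      constructor
      · intro hw
        by_cases hwQ : w ∈ Q
        · exact Or.inr hwQ
        · have : w ∈ P \ Q := ⟨hw, hwQ⟩
          rw [hx] at this
          exact Or.inl this
      · rintro (rfl | hw)
        · exact hxmem.1
        · exact hQP hw
    have hle : M.eRk P ≤ M.eRk Q + 1 := by rw [hPeq]; exact M.eRk_insert_le_add_one x Q
    calc M.eRk P ≤ M.eRk Q + 1 := hle
      _ ≤ (b : ℕ∞) + 1 := add_le_add hQ.2.2 (le_refl 1)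
      _ = ((b + 1 : ℕ) : ℕ∞) := by push_cast; rfl
  have hfibP : ∀ P ∈ lowRankSets M (k + 1) (b + 1), {R ∈ extensionPairs M k b | R.2 = P}.ncard ≤ k + 1 := by
    rintro P ⟨hPE, hP, -⟩
    have hsub : {R ∈ extensionPairs M k b | R.2 = P} ⊆ (fun Q => (Q, P)) '' {Q : Set α | Q ⊆ P ∧ Q.ncard = k} := by
      rintro ⟨Q, P'⟩ ⟨⟨hQ, -, -, hQP⟩, hPP⟩
      have hPP' : P' = P := hPP
      subst hPP'
      exact ⟨Q, ⟨hQP, hQ.2.1⟩, rfl⟩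
    have hfin : {Q : Set α | Q ⊆ P ∧ Q.ncard = k}.Finite :=
      (M.ground_finite.subset hPE).finite_subsets.subset (fun _ h => h.1)
    refine (ncard_le_ncard hsub (hfin.image _)).trans ((ncard_image_le hfin).trans ?_)
    rw [ncard_setOf_subset_ncard_eq (M.ground_finite.subset hPE) k, hP, Nat.choose_succ_self_right]
  calc (M.E.ncard - k) * (lowRankSets M k b).ncard = (extensionPairs M k b).ncard := hlow
    _ ≤ (⋃ P ∈ lowRankSets M (k + 1) (b + 1), {R ∈ extensionPairs M k b | R.2 = P}).ncard :=
        ncard_le_ncard hup (hLfin.biUnion (fun P _ => hIfin.subset (fun R hR => hR.1)))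
    _ ≤ ∑ᶠ P ∈ lowRankSets M (k + 1) (b + 1), {R ∈ extensionPairs M k b | R.2 = P}.ncard :=
        hLfin.ncard_biUnion_le _
    _ = ∑ P ∈ hLfin.toFinset, {R ∈ extensionPairs M k b | R.2 = P}.ncard := finsum_mem_eq_finite_toFinset_sum _ hLfin
    _ ≤ hLfin.toFinset.card • (k + 1) := by
        apply Finset.sum_le_card_nsmul
        intro P hP
        rw [Finite.mem_toFinset] at hP
        exact hfibP P hP
    _ = (k + 1) * (lowRankSets M (k + 1) (b + 1)).ncard := by
        rw [smul_eq_mul, ← ncard_eq_toFinset_card _ hLfin, mul_comm]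

end S1

end PercRepro
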